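import Mathlib
import Literature.NumberTheory.EllipticCurves.PadicSigmaOddPrime
import Literature.NumberTheory.EllipticCurves.IsogenyMordellWeilRankProofs
import Literature.NumberTheory.EllipticCurves.BSDQuadraticDescentCasselsProofs
import HarnessLib

/-!
# CanonicalPAdicHeightIsogenyAdjoint

Topic `Literature/NumberTheory/EllipticCurves`. Named literature fact(s) relocated by the gate from `Summits/BirchSwinnertonDyer/BirchSwinnertonDyer/Theorems/SlopeDichotomyA2DegenerateLocusA2HeightIntegralityIsogeny.lean`
(accept-time relocation of `[cite]`d propositions written inline in a Summits proposal; human ruling 2026-08-15).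
Sources: MazurSteinTate2006, MazurTate1983Biext, SilvermanAEC2009.

* `Literature.NumberTheory.EllipticCurves.canonicalPAdicHeight_isogeny_adjoint`
-/

namespace Literature.NumberTheory.EllipticCurves

open scoped Classical MatrixGroups ModularForm
open PowerSeries CongruenceSubgroup WeierstrassCurve Literature.NumberTheory.EllipticCurves

/-- **Mazur–Tate 1983, (3.4.3) «Change of abelian variety» — an isogeny and its dual are adjoint for THE
canonical cyclotomic `p`-adic height pairings: `⟨φ P, Q'⟩_{E'} = ⟨P, φ̂ Q'⟩_E`.** Printed: for a
homomorphism `f : A → B` of abelian varieties over a global field with dual `f' : B' → A'`, and any admissible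
`ρ`, `(fa, b')_ρ = (a, f'b')_ρ` for `a ∈ A(K)`, `b' ∈ B'(K)` (canonical `ρ`-pairings relative to the Poincaré
biextensions `E^B`, `E^A`). Read for elliptic curves over `ℚ` (`E ≅ E'` by the canonical principal
polarisation, under which the dual homomorphism of an isogeny `φ` is the dual isogeny `φ̂`, `φ̂ ∘ φ = [deg φ]`,
Silverman AEC III.6.1–6.2) and `ρ = ρ^ℚ_cycl` the cyclotomic idèle class character (Mazur–Stein–Tate 2006
§2.8), whose canonical `ρ`-pairing is the pairing the tree PINS by the sigma formula
(`WeierstrassCurve.PAdicHeightData.IsCanonical`: `⟨P,P⟩ = log_p den x(P) − 2 log_p σ_p(z(P))` on admissible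
points = `−2p·h_p` of MST 2006 §1/§2.7, the Mazur–Tate canonical height of (E, ℚ, ρ_cycl), MST §1 fn. 1).
Statement (the shape of the tree THEOREM `WeierstrassCurve.Isogeny.heightPairing_pointHom_left` for the
Néron–Tate pairing, Milne ADT I.7.3 p. 97): for globally minimal elliptic `W, W'/ℚ`, an odd prime `p` of good
ordinary reduction for both, a `ℚ`-isogeny `φ : W → W'` with dual `ψ` (`ψ ∘ φ = [deg φ]` on `E(ℚ̄)`), the induced
maps `f = φ(ℚ)`, `g = ψ(ℚ)` on rational points, and THE canonical data `D`, `D'`: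
`D'.pairing (f P) Q = D.pairing P (g Q)` for all `P ∈ E(ℚ)`, `Q ∈ E'(ℚ)`. Named fact (D-0014): nothing is
asserted; users take `(h : canonicalPAdicHeight_isogeny_adjoint)`.
[cite: MazurTate1983Biext, §3.4 (3.4.3) «Change of abelian variety» (corollary display `(fa,b')_ρ = (a,f'b')_ρ`)]
[cite: MazurSteinTate2006, §1 (footnote 1) and §2.7–2.8 (cyclotomic `p`-adic height `h_ρ`)]
[cite: SilvermanAEC2009, III.6.1–6.2 (dual isogeny, `φ̂ ∘ φ = [m]`)]
[file NumberTheory/EllipticCurves/CanonicalPAdicHeightIsogenyAdjoint] -/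
def canonicalPAdicHeight_isogeny_adjoint : Prop :=
  ∀ (W W' : WeierstrassCurve ℚ) [DecidableEq ℚ] [W.IsElliptic] [W'.IsElliptic] [W.IsGloballyMinimal]
    [W'.IsGloballyMinimal] (p : ℕ) [Fact p.Prime], p ≠ 2 →
    W.HasGoodReductionAtPrime p → ¬ (p : ℤ) ∣ W.frobeniusTrace p →
    W'.HasGoodReductionAtPrime p → ¬ (p : ℤ) ∣ W'.frobeniusTrace p →
    ∀ (φ : WeierstrassCurve.Isogeny W W') (ψ : WeierstrassCurve.Isogeny W' W),
      (∀ P : W.geomPoints, ψ (φ P) = (φ.degree : ℤ) • P) →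
    ∀ (f : W.toAffine.Point →+ W'.toAffine.Point),
      (∀ P : W.toAffine.Point, W'.toGeomPoints (f P) = φ (W.toGeomPoints P)) →
    ∀ (g : W'.toAffine.Point →+ W.toAffine.Point),
      (∀ Q : W'.toAffine.Point, W.toGeomPoints (g Q) = ψ (W'.toGeomPoints Q)) →
    ∀ (D : WeierstrassCurve.PAdicHeightData W p) (D' : WeierstrassCurve.PAdicHeightData W' p),
      D.IsCanonical → D'.IsCanonical →
    ∀ (P : W.toAffine.Point) (Q : W'.toAffine.Point), D'.pairing (f P) Q = D.pairing P (g Q)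

end Literature.NumberTheory.EllipticCurves
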